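import Summits.QuantumFields.BalabanUV.T4Continuum.Support.B13StepTermExpLinear
import Summits.QuantumFields.BalabanUV.T4Continuum.Support.B13HistReadout
import Summits.QuantumFields.BalabanUV.T4Continuum.Support.B13OpDatumJunctions
import Summits.QuantumFields.BalabanUV.T4Continuum.Support.B13TermHistSecant

/-!
# NE5 ∕ U3 — (2.14)-TERM DATA READ THROUGH THE RECORDS: route P2's `TermDatum` with leaf-07's operator read-outs and leaf-06's history
# read-out BY CONSTRUCTION; the term CORES stay parameters; this row's structure `LinearHistoryOn` ⇒ `ActExpLinearOn` ∕ `TermHistExpLinear`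
# follows modulo ONE displayed one-run binder (row O1-d2 follower, part 1 of 2; part 2 = `B13StepOfRecordTermData` on the model of record)

Cell `pub-balaban`, unit `b2b-balaban-t4-ne5-formalise-leaf-08` (NE5 formalisation swarm, LEAF PROVER 08, gen 2; row O1-d2 holder —
`Support/B13StepTermFamily` p207797, `Support/B13StepTermExpLinear` p208225; claim table `t4/b2b-balaban-t4-ne5-p1/O1-CLAIM-TABLE-NE5-P1.md`).
Summits-side NEW WORK under the LEAN PLACEMENT RULE (cell modelling + bookkeeping; NOT a Literature module).  HONEST FRAMING: rung (B)+1 of the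
FINITE-VOLUME T⁴ continuum programme — NOT infinite volume, NOT a mass gap, NOT the Clay problem, NOT a proof of NE5 (NOT PRINTED:
[Balaban1987RG1]–[Balaban1989LargeFieldII] print ε-UNIFORM bounds, never η-RATES; cell GAPS G-t4-U3-1).  HONEST DEPENDENCY (cell line, verbatim):
continuum YM on T⁴ ⇐ BetaPertH ∧ nine spine estimates (0/9 proved); BetaPertH ⇐ (D1) ∧ (D4) ∧ CAP+tail; G-an2-4 gates asym, D1 and NE2/3/4.

WHY.  The instancer `B13StepOfRecord` (leaf-09, p208933) keeps the (2.14)-activity slot `act : Dom → InnerLabel → OpDatum E → Hist → ℂ` of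
[Balaban1988RG2Cluster] p. 15 as an ARBITRARY functional, so every history-side input of the END faces on the model of record (`ActExpLinearOn`,
`ActExpNormBound`, …) is a displayed binder there.  The owner's design (v0.2, Q1) and this row's junction p208225 say what `act` IS short of
Bałaban's concrete contours and Gaussian measures: `actOf 𝔱` for terms of route P2's format `ActivityTermDatum.TermDatum` (p195577:
`z(o)⁻¹ • ∫ exp(−(opForm o x + histForm h x)) • F₀ x dν`) whose five kernel read-outs are leaf-07's coordinate read-outs of the operator datum
(`B13OpDatumJunctions.readouts`, p207906) and whose history read-out is leaf-06's `B13HistReadout.readVpp` through the MEASURABLE table space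
`B13HistM` (p209145; fork F2's default).  This file performs that substitution for a generic carriers `C` and term indexing:
* §1 `TermCore P dom T κ ι Ω Ω₀ 𝒞` = what is left of ONE (2.14)-term once both read-outs are of record (Gaussian slot, potential bookkeeping,
  MEASURABLE field-configuration maps `B Y : Ω → P.Arg (dom Y)`, integration data with `SigmaFinite ν` — side conditions, no inequality);
  `TermCore.toTermDatum F G ϱ` (kernels `entry F o (Species.• …)` in the step's format `F`, letters `d p q τ w kk` of leaf-07's `B13Weights G`, `read := readVpp P dom B`,
  `𝐕″`-format `v Y := ϱ·‖τ Y‖·level136 (d (dom Y))` — leaf-06's (1.36)×(2.18) currency), its field lemmas (`rfl`).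
* §2 ROUTE P2's READING BY NAME: `reads_toTermDatum` (`LinearReadouts.Reads`, `rfl`), `calibrated_toTermDatum` (`Calibrated … 1 1 1 1 λR` from
  `calibrated_readouts_of_dominated`; the only inequality is a FORMAT domination between the instancer's own letters), `readLip_toTermDatum`
  (P2's `ReadLip` — leaf L05's operator-slot modelling — from `Geometry` + margin inequalities, `readLip_of_linear` BY NAME), `read_toTermDatum`,
  `readAdditive_toTermDatum`, `readUnitBound_toTermDatum`, `histm_toTermDatum` (leaf-06 BY NAME).
* §3 the family `termData F G rH 𝔗 Z j := (𝔗 Z j).toTermDatum (G (scale Z)) (rH (scale Z))` with history functionals `histLs` and margins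
  `margins rH`; **`linearHistoryOn_termData`** (this row's `LinearHistoryOn` for ANY term indexing over `C.Dom`, from `rH > 0` and ONE displayed
  one-run binder `refF` = integrability of every factor's tilted integrand at the class points — P2's `RefAt.hF`, (2.15) p. 15 KIND, inline,
  no `def … : Prop` — the six other clauses are theorems); hence `actExpLinearOn_termData`,
  `termHistExpLinear_termData`, `termHistLineAnalytic_termData` (leaf L04's history STRUCTURE), `actExpNormBound_termData` (leaf-03's binder with
  the EXPLICIT modulus `r k·Σ_{Y∈𝐃} ‖τ Y‖·level136 (d (dom Y))`, (2.20) KIND) and `actAbsBound_termData` (leaf-03's absolute majorant READ AS the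
  (2.15) quantity `‖z⁻¹‖·∫‖F‖`) — all BY NAME.
HONEST RESIDUE.  NOT the owner's sub-row «O1-d2-ii act instance»: the cores are NAMED PARAMETERS (as `Slots` is); no identification with [II]'s
contours (2.18), Gaussian measures (2.16)–(2.17) or characteristic functions; no estimate of [II] proved or asserted; `BetaPertH`, (B), (B^μ)
absent.  0 sorry; axioms ⊆ {propext, Classical.choice, Quot.sound}.
-/

noncomputable section

open MeasureTheory
open scoped BigOperators

namespace Summit.QuantumFields.BalabanUV.T4Continuum.B13TermData

open Literature.MathematicalPhysics.QuantumFieldTheory.Balaban1983to89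
open Literature.MathematicalPhysics.QuantumFieldTheory.Balaban1983to89.T4OutputRate (Carriers)
open Literature.MathematicalPhysics.QuantumFieldTheory.Balaban1983to89.T4InputCauchyRateTermwise
  (TermHistExpLinear TermHistLineAnalytic)
open Literature.MathematicalPhysics.QuantumFieldTheory.Balaban1983to89.T4ActivityTiltHistory (ReadAdditive ReadUnitBound)
open Summit.QuantumFields.BalabanUV.T4Continuum.ActivityTermModel (TermDatum TermConsts)
open Summit.QuantumFields.BalabanUV.T4Continuum.ActivityTermReadouts (LinearReadouts)
open Summit.QuantumFields.BalabanUV.T4Continuum.B13OpDatum (Format OpDatum entry Species B13Weights)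
open Summit.QuantumFields.BalabanUV.T4Continuum.B13OpDatumJunctions (readouts calibrated_readouts_of_dominated)
open Summit.QuantumFields.BalabanUV.T4Continuum.B13HistDatum (level136 level136_pos)
open Summit.QuantumFields.BalabanUV.T4Continuum.B13HistMeasurable (MeasPotFrame B13HistM)
open Summit.QuantumFields.BalabanUV.T4Continuum.B13HistReadout
  (readVpp VppCLMM readVpp_eq_clm readAdditive_readVpp readUnitBound_readVpp aestronglyMeasurable_histForm)
open Summit.QuantumFields.BalabanUV.T4Continuum.B13StepTermFamily
  (TermIndexing ActExpLinearOn term tupleMeasure tupleWeight tupleFunctional)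
open Summit.QuantumFields.BalabanUV.T4Continuum.B13StepTermExpLinear
  (actOf dataOf LinearHistoryOn actExpLinearOn_of_linearHistory termHistExpLinear_of_linearHistory
    termHistLineAnalytic_of_linearHistory)
open Summit.QuantumFields.BalabanUV.T4Continuum.B13TermHistSecant
  (ActExpNormBound ActAbsBound actExpNormBound_of_linearHistory actAbsBound_of_linearHistory_normF)

/-! ## §1 The residual data of one (2.14)-term once its two read-outs are of record -/

section Core

variable {C : Carriers} (P : MeasPotFrame C) {𝒴 : Type*} (dom : 𝒴 → C.Dom) (T κ ι Ω Ω₀ 𝒞 : Type*)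
  [MeasurableSpace Ω] [MeasurableSpace Ω₀]

/-- [folklore] DATA (side conditions `measB`, `sigmaFinite` only; no inequality): THE CORE OF ONE (2.14)-TERM — what remains of route P2's
`TermDatum` once the kernel read-outs are leaf-07's coordinate read-outs of the operator datum and the history read-out is leaf-06's
`readVpp` through the table: the Gaussian slot `slot : T` the term reads (its `Z₀`∕decoupling resolution), the potential bookkeeping of
(2.14)'s last exponential (history labels `D`, their bonds, cubes, the pinned cubes `cubes₀` of (2.20)), the field configuration
`B Y x : P.Arg (dom Y)` seen by the table entry `𝐕″(Y, ·)` at integration point `x` (MEASURABLE in `x`), the term's integration datum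
`ν, F₀, Xf, Bf` ((2.14): contour parameters × Gaussian variables, the untilted integrand, the real Gaussian variables; `ν` σ-finite) and
its normalisation's `ν₀, φ₀, B₀f`.  NAMED PARAMETERS of the instantiation — nothing of [II] is constructed here. -/
structure TermCore where
  /-- the Gaussian slot read by the three kernel species -/
  slot : T
  /-- history labels `Y ∈ 𝐃` of the last exponential of (2.14) -/
  D : Finset 𝒴
  /-- bonds of a label -/
  bonds : 𝒴 → Finset κ
  /-- cubes of a label -/
  cubes : 𝒴 → Finset 𝒞
  /-- the pinned cubes ((2.20)'s `Y₀`) -/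
  cubes₀ : Finset 𝒞
  /-- the field configuration read by `𝐕″(Y, ·)` at the integration point -/
  B : (Y : 𝒴) → Ω → P.Arg (dom Y)
  /-- … measurable in the integration point -/
  measB : ∀ Y, Measurable (B Y)
  /-- the term's measure -/
  ν : Measure Ω
  /-- … σ-finite -/
  sigmaFinite : SigmaFinite ν
  /-- the untilted integrand -/
  F₀ : Ω → ℂ
  /-- the real `X`-variables -/
  Xf : Ω → ι → ℝ
  /-- the real `B`-variables -/
  Bf : Ω → κ → ℝ
  /-- the normalisation's measure -/
  ν₀ : Measure Ω₀
  /-- the normalisation's integrand -/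
  φ₀ : Ω₀ → ℂ
  /-- the normalisation's Gaussian variables -/
  B₀f : Ω₀ → κ → ℝ

namespace TermCore

variable {P dom T κ ι Ω Ω₀ 𝒞} {S : Type*} (𝔠 : TermCore P dom T κ ι Ω Ω₀ 𝒞) (F : Format (Species T κ ι Ω 𝒴))
  (G : B13Weights κ ι S 𝒴) (ϱ : ℝ)

/-- [folklore] THE HISTORY FUNCTIONALS of the core: at label `Y` and integration point `x`, the table entry `𝐕″(dom Y, B Y x)` as a
continuous linear functional on the measurable history space (leaf-06's `VppCLMM`). -/
def histL : 𝒴 → Ω → (B13HistM P →L[ℂ] ℂ) := fun Y x => VppCLMM P (dom Y) (𝔠.B Y x)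

/-- [folklore] **THE (2.14)-TERM DATUM OF A CORE** in route P2's format, with the operator read-outs OF RECORD (the entries of the datum
in the step's entry format `F` at the core's slot — leaf-07's `entry F`: `kL ↦ gammaConstituent`, `kA ↦ deltaKer`, `kP ↦ cov`, `kQ ↦ potQ`,
`kR ↦ potR`; `F` is the instancer's per-step format, fork F1 untouched), the history read-out OF RECORD (`readVpp` through the measurable
table), the geometry letters `d p q τ w kk` of leaf-07's B13 weights `G`, and the `𝐕″`-format `v Y := ϱ·‖τ Y‖·level136 (d (dom Y))` in
history-margin units `ϱ`. -/
def toTermDatum : TermDatum (OpDatum (Species T κ ι Ω 𝒴)) (B13HistM P) ι κ S Ω Ω₀ 𝒴 𝒞 where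
  d := G.d
  p := G.p
  q := G.q
  kL o a' i := entry F o (.gammaConstituent 𝔠.slot a' i)
  kA o := Matrix.of fun i j => entry F o (.deltaKer 𝔠.slot i j)
  kP o := Matrix.of fun a' a'' => entry F o (.cov 𝔠.slot a' a'')
  D := 𝔠.D
  bonds := 𝔠.bonds
  cubes := 𝔠.cubes
  cubes₀ := 𝔠.cubes₀
  τ := G.τ
  kQ o x Y b b' := entry F o (.potQ x Y b b')
  kR o x Y := entry F o (.potR x Y)
  w := G.w
  kk := G.kk
  v Y := ϱ * (‖G.τ Y‖ * level136 P.consts (C.d (dom Y)))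
  read := readVpp P dom 𝔠.B
  ν := 𝔠.ν
  F₀ := 𝔠.F₀
  Xf := 𝔠.Xf
  Bf := 𝔠.Bf
  ν₀ := 𝔠.ν₀
  φ₀ := 𝔠.φ₀
  B₀f := 𝔠.B₀f

/-- [folklore] The fields of the term datum of a core (all `rfl`). -/
@[simp] theorem toTermDatum_d : (𝔠.toTermDatum F G ϱ).d = G.d := rfl
/-- [folklore] -/ @[simp] theorem toTermDatum_p : (𝔠.toTermDatum F G ϱ).p = G.p := rfl
/-- [folklore] -/ @[simp] theorem toTermDatum_q : (𝔠.toTermDatum F G ϱ).q = G.q := rfl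
/-- [folklore] -/ @[simp] theorem toTermDatum_τ : (𝔠.toTermDatum F G ϱ).τ = G.τ := rfl
/-- [folklore] -/ @[simp] theorem toTermDatum_w : (𝔠.toTermDatum F G ϱ).w = G.w := rfl
/-- [folklore] -/ @[simp] theorem toTermDatum_kk : (𝔠.toTermDatum F G ϱ).kk = G.kk := rfl
/-- [folklore] -/ @[simp] theorem toTermDatum_D : (𝔠.toTermDatum F G ϱ).D = 𝔠.D := rfl
/-- [folklore] -/ @[simp] theorem toTermDatum_bonds : (𝔠.toTermDatum F G ϱ).bonds = 𝔠.bonds := rfl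
/-- [folklore] -/ @[simp] theorem toTermDatum_ν : (𝔠.toTermDatum F G ϱ).ν = 𝔠.ν := rfl
/-- [folklore] -/
@[simp] theorem toTermDatum_v (Y : 𝒴) : (𝔠.toTermDatum F G ϱ).v Y = ϱ * (‖G.τ Y‖ * level136 P.consts (C.d (dom Y))) := rfl
/-- [folklore] -/ @[simp] theorem toTermDatum_read : (𝔠.toTermDatum F G ϱ).read = readVpp P dom 𝔠.B := rfl
/-- [folklore] -/
@[simp] theorem toTermDatum_kP (o : OpDatum (Species T κ ι Ω 𝒴)) (a' a'' : κ) :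
    (𝔠.toTermDatum F G ϱ).kP o a' a'' = entry F o (.cov 𝔠.slot a' a'') := rfl
/-- [folklore] -/
@[simp] theorem toTermDatum_kA (o : OpDatum (Species T κ ι Ω 𝒴)) (i j : ι) :
    (𝔠.toTermDatum F G ϱ).kA o i j = entry F o (.deltaKer 𝔠.slot i j) := rfl
/-- [folklore] -/
@[simp] theorem toTermDatum_kL (o : OpDatum (Species T κ ι Ω 𝒴)) (a' : κ) (i : ι) :
    (𝔠.toTermDatum F G ϱ).kL o a' i = entry F o (.gammaConstituent 𝔠.slot a' i) := rfl
/-- [folklore] -/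
@[simp] theorem toTermDatum_kQ (o : OpDatum (Species T κ ι Ω 𝒴)) (x : Ω) (Y : 𝒴) (b b' : κ) :
    (𝔠.toTermDatum F G ϱ).kQ o x Y b b' = entry F o (.potQ x Y b b') := rfl
/-- [folklore] -/
@[simp] theorem toTermDatum_kR (o : OpDatum (Species T κ ι Ω 𝒴)) (x : Ω) (Y : 𝒴) :
    (𝔠.toTermDatum F G ϱ).kR o x Y = entry F o (.potR x Y) := rfl

/-! ## §2 Route P2's reading of the operator slot and its history clauses, BY NAME -/

/-- [folklore] **P2's `Reads` BY CONSTRUCTION**: the five kernel read-outs of the term datum of a core ARE leaf-07's coordinate read-outs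
`readouts F slot` of the operator datum in the step's format (`rfl`). -/
theorem reads_toTermDatum : (readouts F 𝔠.slot).Reads (𝔠.toTermDatum F G ϱ) where
  hL _ _ _ := rfl
  hA _ _ _ := rfl
  hP _ _ _ := rfl
  hQ _ _ _ _ _ := rfl
  hR _ _ _ := rfl

variable {G ϱ} in
/-- [folklore] **P2's `Calibrated` IN THE B13 FORMAT OF THE SAME WEIGHTS** (`F := G.format`; leaf-07's `calibrated_readouts_of_dominated` BY
NAME): with the format's decay rate equal to the term constants' (`G.δ = 𝔡.δ`) the three Gaussian read-outs and the `Q`-read-out are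
calibrated with modulus `1` (the letters `d p q τ w kk` ARE the format's), and the `𝐕″`-read-out with any modulus `λR` dominating the
format's `𝐕″`-weight by the term's `v`-format: `G.v Y ≤ λR·(ϱ·‖τ Y‖·level136 (d (dom Y)))` on the core's labels — an inequality among the
instancer's own letters.  (Other formats, e.g. fork F1's `rpowFormat`, calibrate by `calibrated_readouts_of_dominated` directly.) -/
theorem calibrated_toTermDatum (𝔡 : TermConsts) (hδ : G.δ = 𝔡.δ) {lamR : ℝ}
    (hvR : ∀ Y ∈ 𝔠.D, G.v Y ≤ lamR * (ϱ * (‖G.τ Y‖ * level136 P.consts (C.d (dom Y))))) :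
    (readouts (G.format (T := T) (Ω := Ω)) 𝔠.slot).Calibrated (𝔠.toTermDatum G.format G ϱ) 𝔡 1 1 1 1 lamR := by
  refine calibrated_readouts_of_dominated _ _ _ 𝔡 ?_ ?_ ?_ ?_ ?_
  · intro a' i
    rw [B13Weights.format_wt, B13Weights.wt, toTermDatum_d, toTermDatum_q, toTermDatum_p, hδ, one_mul]
  · intro i j
    rw [B13Weights.format_wt, B13Weights.wt, toTermDatum_d, toTermDatum_p, hδ, one_mul]
  · intro a' a''
    rw [B13Weights.format_wt, B13Weights.wt, toTermDatum_d, toTermDatum_q, hδ, one_mul]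
  · intro x Y _ b _ b' _
    have hτY : ‖G.τ Y‖ ≠ 0 := norm_ne_zero_iff.2 (G.τ_ne Y)
    rw [B13Weights.format_wt, B13Weights.wt, toTermDatum_τ, toTermDatum_w, toTermDatum_kk, one_mul, mul_div_cancel₀ _ hτY]
  · intro x Y hY
    have hτY : ‖G.τ Y‖ ≠ 0 := norm_ne_zero_iff.2 (G.τ_ne Y)
    rw [B13Weights.format_wt, B13Weights.wt, toTermDatum_τ, toTermDatum_v, mul_div_cancel₀ _ hτY]
    exact hvR Y hY

/-- [folklore] **P2's `ReadLip` FOR A TERM OF RECORD** (leaf L05's operator-slot modelling, `ActivityTermReadouts.readLip_of_linear` BY NAME):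
in the B13 format of the same weights, from the format equality `G.δ = 𝔡.δ`, the ONE format inequality of `calibrated_toTermDatum`, P2's one-run
geometric bookkeeping shape `Geometry 𝔡` (displayed), margins `0 < ϱOp ≤ κL, κA, κP, κQ` and `ϱOp·λR ≤ κR` (inequalities among the instancer's
constants), and `ϱ > 0` — the two history clauses being leaf-06's theorems. -/
theorem readLip_toTermDatum [Fintype ι] [Fintype κ] [DecidableEq ι] [DecidableEq κ] [DecidableEq 𝒞] (𝔡 : TermConsts) (hδ : G.δ = 𝔡.δ) {lamR ϱOp : ℝ}
    (hvR : ∀ Y ∈ 𝔠.D, G.v Y ≤ lamR * (ϱ * (‖G.τ Y‖ * level136 P.consts (C.d (dom Y)))))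
    (hgeo : (𝔠.toTermDatum G.format G ϱ).Geometry 𝔡) (hϱOp : 0 < ϱOp) (hϱ : 0 < ϱ) (hκL : ϱOp ≤ 𝔡.κL) (hκA : ϱOp ≤ 𝔡.κA)
    (hκP : ϱOp ≤ 𝔡.κP) (hκQ : ϱOp ≤ 𝔡.κQ) (hκR : ϱOp * lamR ≤ 𝔡.κR) :
    (𝔠.toTermDatum G.format G ϱ).ReadLip 𝔡 ϱOp ϱ :=
  LinearReadouts.readLip_of_linear (𝔠.reads_toTermDatum _ G ϱ) (𝔠.calibrated_toTermDatum 𝔡 hδ hvR) hgeo hϱOp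
    (by rw [mul_one]; exact hκL) (by rw [mul_one]; exact hκA) (by rw [mul_one]; exact hκP) (by rw [mul_one]; exact hκQ) hκR
    (readAdditive_readVpp P dom 𝔠.B) (readUnitBound_readVpp P dom 𝔠.B 𝔠.D G.τ hϱ)

/-- [folklore] **`LinearHistoryOn.read` BY CONSTRUCTION**: the history read-out of the term datum of a core IS the CLM family `histL` applied
to the table (leaf-06's `readVpp_eq_clm`). -/
theorem read_toTermDatum (h : B13HistM P) (Y : 𝒴) (x : Ω) : (𝔠.toTermDatum F G ϱ).read h Y x = 𝔠.histL Y x h :=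
  readVpp_eq_clm P dom 𝔠.B h Y x

/-- [folklore] **P2's `ReadAdditive` BY CONSTRUCTION** (leaf-06 BY NAME). -/
theorem readAdditive_toTermDatum : ReadAdditive (𝔠.toTermDatum F G ϱ).read := readAdditive_readVpp P dom 𝔠.B

variable {ϱ} in
/-- [folklore] **P2's `ReadUnitBound` BY CONSTRUCTION** in the margin `ϱ > 0` the `v`-format was written in (leaf-06 BY NAME). -/
theorem readUnitBound_toTermDatum (hϱ : 0 < ϱ) :
    ReadUnitBound (𝔠.toTermDatum F G ϱ).read (𝔠.toTermDatum F G ϱ).D (𝔠.toTermDatum F G ϱ).τ (𝔠.toTermDatum F G ϱ).v ϱ :=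
  readUnitBound_readVpp P dom 𝔠.B 𝔠.D G.τ hϱ

variable {ϱ} in
/-- [folklore] The `v`-format is nonnegative for `ϱ ≥ 0` (`level136 > 0` on the frame's positive units). -/
theorem v_nonneg_toTermDatum (hϱ : 0 ≤ ϱ) (Y : 𝒴) : 0 ≤ (𝔠.toTermDatum F G ϱ).v Y :=
  mul_nonneg hϱ (mul_nonneg (norm_nonneg _) (level136_pos P.pos _).le)

/-- [folklore] **`LinearHistoryOn.histm` BY CONSTRUCTION**: for EVERY measurable table `y` the history exponent `x ↦ histForm y x` of the
term datum of a core is a.e.-strongly measurable for the core's measure (leaf-06's `aestronglyMeasurable_histForm`, the field maps being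
measurable by `measB`). -/
theorem histm_toTermDatum (y : B13HistM P) :
    AEStronglyMeasurable (fun x => (𝔠.toTermDatum F G ϱ).histForm y x) (𝔠.toTermDatum F G ϱ).ν :=
  aestronglyMeasurable_histForm P dom 𝔠.B (𝔠.toTermDatum F G ϱ) (fun _ _ _ => rfl) 𝔠.measB y

end TermCore

/-! ## §3 The family of term data over the carriers' domains and this row's structure `LinearHistoryOn`, by construction -/

variable {P dom T κ ι Ω Ω₀ 𝒞} {S J : Type*}

/-- [folklore] THE TERM DATA OF A FAMILY OF CORES `𝔗 Z j` (polymer `Z`, inner label `j`): the core's datum in the entry format, the weights and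
the history margin OF THE POLYMER's SCALE (`F (scale Z)`, `G (scale Z)`, `rH (scale Z)` — the step the term belongs to). -/
def termData (F : ℕ → Format (Species T κ ι Ω 𝒴)) (G : ℕ → B13Weights κ ι S 𝒴) (rH : ℕ → ℝ)
    (𝔗 : C.Dom → J → TermCore P dom T κ ι Ω Ω₀ 𝒞) :
    C.Dom → J → TermDatum (OpDatum (Species T κ ι Ω 𝒴)) (B13HistM P) ι κ S Ω Ω₀ 𝒴 𝒞 :=
  fun Z j => (𝔗 Z j).toTermDatum (F (C.scale Z)) (G (C.scale Z)) (rH (C.scale Z))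

/-- [folklore] The history functionals of the family. -/
def histLs (𝔗 : C.Dom → J → TermCore P dom T κ ι Ω Ω₀ 𝒞) : C.Dom → J → 𝒴 → Ω → (B13HistM P →L[ℂ] ℂ) :=
  fun Z j => (𝔗 Z j).histL

/-- [folklore] The history margins of the family: the margin of the polymer's scale. -/
def margins (rH : ℕ → ℝ) : C.Dom → J → ℝ := fun Z _ => rH (C.scale Z)

/-- [folklore] THE ACTIVITY SLOT IN TERM FORMAT: `actOf (termData F G rH 𝔗)`, i.e. `act Z j o h = ((𝔗 Z j).toTermDatum …).term (o, h)`. -/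
theorem actOf_termData (F : ℕ → Format (Species T κ ι Ω 𝒴)) (G : ℕ → B13Weights κ ι S 𝒴) (rH : ℕ → ℝ)
    (𝔗 : C.Dom → J → TermCore P dom T κ ι Ω Ω₀ 𝒞) [Fintype ι] [Fintype κ] [DecidableEq ι] [DecidableEq κ] (Z : C.Dom) (j : J)
    (o : OpDatum (Species T κ ι Ω 𝒴)) (h : B13HistM P) :
    actOf (termData F G rH 𝔗) Z j o h = ((𝔗 Z j).toTermDatum (F (C.scale Z)) (G (C.scale Z)) (rH (C.scale Z))).term (o, h) := rfl

section Structure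

variable [Fintype ι] [Fintype κ] [DecidableEq ι] [DecidableEq κ] {ιT : Type*} (𝒯 : TermIndexing C ιT C.Dom J)
  (F : ℕ → Format (Species T κ ι Ω 𝒴)) (G : ℕ → B13Weights κ ι S 𝒴) (rH : ℕ → ℝ) (𝔗 : C.Dom → J → TermCore P dom T κ ι Ω Ω₀ 𝒞)
  {K : ℕ → (ℕ → ℝ) → C.BgB → Set (OpDatum (Species T κ ι Ω 𝒴) × B13HistM P)} {W : Set (ℕ → ℝ)}

/-! THE TWO BINDERS OF THIS SECTION (section variables, included in every theorem below): positive history margins `hrH`, and the ONE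
displayed one-run binder `refF` — at every class point `q` of step `k`, every factor `(Z, j)` of every tuple localizing at a step-`k` domain
has an INTEGRABLE tilted integrand `F q` for its own measure (route P2's `RefAt.hF`, the one-run integrability behind (2.15) p. 15 of
[Balaban1988RG2Cluster]; KIND, locator only, asserted nowhere; it is the field `refF` of this row's `LinearHistoryOn`, displayed alone). -/
variable (hrH : ∀ k, 0 < rH k)
  (refF : ∀ k, ∀ g ∈ W, ∀ (U : C.BgB) (q : OpDatum (Species T κ ι Ω 𝒴) × B13HistM P), q ∈ K k g U →
    ∀ X : C.Dom, C.scale X = k → ∀ i, 𝒯.Rel k i X → ∀ m,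
      Integrable ((termData F G rH 𝔗 (𝒯.poly i m) (𝒯.lab i m)).F q) (𝔗 (𝒯.poly i m) (𝒯.lab i m)).ν)
include hrH refF

/-- [folklore] **THIS ROW's `LinearHistoryOn` HOLDS BY CONSTRUCTION for term data read through the records**, for ANY term indexing over
the carriers' domains and ANY class, from positive history margins and EXACTLY ONE displayed one-run binder `refF` (integrability of
every factor's tilted integrand at the class points).  The clauses `read ∕ pos ∕ nonneg ∕ unit ∕ sigmaFinite ∕ histm` are §2's theorems
and the cores' side conditions. -/
theorem linearHistoryOn_termData : LinearHistoryOn 𝒯 (termData F G rH 𝔗) (histLs 𝔗) (margins rH) K W where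
  read Z j h Y x := (𝔗 Z j).read_toTermDatum _ _ _ h Y x
  pos Z _ := hrH (C.scale Z)
  nonneg Z j Y _ := (𝔗 Z j).v_nonneg_toTermDatum _ _ (hrH (C.scale Z)).le Y
  unit Z j := (𝔗 Z j).readUnitBound_toTermDatum _ _ (hrH (C.scale Z))
  sigmaFinite Z j := (𝔗 Z j).sigmaFinite
  histm Z j y := (𝔗 Z j).histm_toTermDatum _ _ _ y
  refF := refF

/-- [folklore] **… HENCE THIS ROW's `ActExpLinearOn`** for the activity slot in term format, with the exhibited data `dataOf` (p208225 BY NAME). -/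
theorem actExpLinearOn_termData :
    ActExpLinearOn 𝒯 (actOf (termData F G rH 𝔗)) (dataOf (termData F G rH 𝔗) (histLs 𝔗)) K W :=
  actExpLinearOn_of_linearHistory (linearHistoryOn_termData 𝒯 F G rH 𝔗 hrH refF)

/-- [folklore] **… HENCE `TermHistExpLinear` WITH EXHIBITED (μ, Φ, Λ)** for the Ursell term family on the activity slot in term format, under
ANY hard core `inc` (p207797's product data: product measures of the cores' `ν`, 𝟙·coefficient·Π `weight`, 𝟙·Σ `histL`). -/
theorem termHistExpLinear_termData (inc : C.Dom → C.Dom → Prop) [DecidableRel inc] :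
    TermHistExpLinear K (term 𝒯 inc (actOf (termData F G rH 𝔗))) W (α := fun _ i => Fin (𝒯.len i + 1) → Ω)
      (fun _ i o _ => tupleMeasure 𝒯 (dataOf (termData F G rH 𝔗) (histLs 𝔗)) i o)
      (fun k i o X => tupleWeight 𝒯 inc (dataOf (termData F G rH 𝔗) (histLs 𝔗)) k i o X)
      (fun k i o X => tupleFunctional 𝒯 (dataOf (termData F G rH 𝔗) (histLs 𝔗)) k i o X) :=
  termHistExpLinear_of_linearHistory inc (linearHistoryOn_termData 𝒯 F G rH 𝔗 hrH refF)

/-- [folklore] **… AND `TermHistLineAnalytic`** (leaf L04's history half, termwise input) with no analyticity hypothesis. -/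
theorem termHistLineAnalytic_termData (inc : C.Dom → C.Dom → Prop) [DecidableRel inc] :
    TermHistLineAnalytic K (term 𝒯 inc (actOf (termData F G rH 𝔗))) W :=
  termHistLineAnalytic_of_linearHistory (inc := inc) (linearHistoryOn_termData 𝒯 F G rH 𝔗 hrH refF)

/-- [folklore] **LEAF-03's EXPONENT-BOUND BINDER WITH AN EXPLICIT MODULUS** (`B13TermHistSecant.actExpNormBound_of_linearHistory` BY NAME, the
margin cancelled): in units `r k ≥ 0` the history functional of the factor `(Z, j)` is bounded by `r k · Σ_{Y ∈ 𝐃(Z j)} ‖τ Y‖·level136 (d (dom Y))`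
— the contour radii times the table's (1.36) level format, summed over the term's history labels ((2.20) p. 16 KIND: in print
`Σ_Y |τ(Y)||𝐕″_k(Y, B)|` is absorbed into `O(1)`; here it is a displayed number per term, nothing asserted). -/
theorem actExpNormBound_termData {r : ℕ → ℝ} (hr : ∀ k, 0 ≤ r k) :
    ActExpNormBound 𝒯 (dataOf (termData F G rH 𝔗) (histLs 𝔗)) K W r
      (fun k _ _ Z j => r k * ∑ Y ∈ (𝔗 Z j).D, ‖(G (C.scale Z)).τ Y‖ * level136 P.consts (C.d (dom Y))) := by
  have h := actExpNormBound_of_linearHistory (linearHistoryOn_termData 𝒯 F G rH 𝔗 hrH refF) hr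
  have heq : (fun (k : ℕ) (_ : ℕ → ℝ) (_ : C.BgB) (Z : C.Dom) (j : J) =>
      r k * ((∑ Y ∈ (termData F G rH 𝔗 Z j).D, (termData F G rH 𝔗 Z j).v Y) / margins rH Z j)) =
      fun k _ _ Z j => r k * ∑ Y ∈ (𝔗 Z j).D, ‖(G (C.scale Z)).τ Y‖ * level136 P.consts (C.d (dom Y)) := by
    funext k g U Z j
    have hϱ : rH (C.scale Z) ≠ 0 := (hrH _).ne'
    simp only [termData, margins, TermCore.toTermDatum_D, TermCore.toTermDatum_v, ← Finset.mul_sum]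
    rw [mul_div_cancel_left₀ _ hϱ]
  rw [heq] at h
  exact h

/-- [folklore] **LEAF-03's ABSOLUTE-MAJORANT BINDER READ AS THE (2.15) QUANTITY** (`actAbsBound_of_linearHistory_normF` BY NAME): a displayed
bound `‖z(q.1)⁻¹‖·∫‖F q‖ dν ≤ A k g U Z j` on every factor at the class points gives `ActAbsBound 𝒯 (dataOf …) K W A`. -/
theorem actAbsBound_termData {A : ℕ → (ℕ → ℝ) → C.BgB → C.Dom → J → ℝ}
    (hA : ∀ k, ∀ g ∈ W, ∀ (U : C.BgB) (q : OpDatum (Species T κ ι Ω 𝒴) × B13HistM P), q ∈ K k g U →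
      ∀ X : C.Dom, C.scale X = k → ∀ i, 𝒯.Rel k i X → ∀ m,
        ‖((termData F G rH 𝔗 (𝒯.poly i m) (𝒯.lab i m)).z q.1)⁻¹‖ *
            ∫ x, ‖(termData F G rH 𝔗 (𝒯.poly i m) (𝒯.lab i m)).F q x‖ ∂(𝔗 (𝒯.poly i m) (𝒯.lab i m)).ν ≤
          A k g U (𝒯.poly i m) (𝒯.lab i m)) :
    ActAbsBound 𝒯 (dataOf (termData F G rH 𝔗) (histLs 𝔗)) K W A :=
  actAbsBound_of_linearHistory_normF (linearHistoryOn_termData 𝒯 F G rH 𝔗 hrH refF) hA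

end Structure

end Core


end Summit.QuantumFields.BalabanUV.T4Continuum.B13TermData

end
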